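import Literature.Probability.Percolation.MarkedLoopLawContract
import HarnessLib

/-!
# Inserting a cap at two adjacent corners of an outermost pattern: the pattern map behind `capInsL`, its closed form, and the law assembly with cap data («PAT-CAPINS»)

Topic `Literature/Probability/Percolation`; the cap-insertion twin of `MarkedLoopPatternContract.lean` («PAT-CONTRACT»: `Pat₀.contract j`, `pat₀EquivLinkPattern_contract`,
`Pat₀.mem_contract_iff`, `contractL_apply_eq_sum`, `lawLP_eq_add_contractL`), on the tree's `LatticeModels/TemperleyLiebCapContract.lean` («TL-CAP-CONTRACT»:
`PerfectMatching.capIns j p` — pair `j` with `j+1`, the other sites as `p` relabelled by `skip j`; `capIns_partner_castSucc/succ/skip`; `LinkPattern.capIns`,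
`contractSucc_capIns`; `capInsL R j = Finsupp.lmapDomain (capIns j)`) and `MarkedLoopLawContract.lean` (`eq_castSucc_or_succ_or_skip`).

Pearce–Rittenberg–de Gier–Nienhuis's CAP half of the monoid move `e_j` (§2), transported to Khristoforov–Smirnov's outermost (partner, link relation) patterns (§1.2):

* `Pat₀.capIns j p` — **THE CAP INSERTION AT THE ADJACENT CORNERS `j, j+1`** of an outermost pattern `p` of `k` corners: an outermost pattern of `k+2` corners, DEFINED through the
  bridge (`pat₀EquivLinkPattern_capIns : pat₀EquivLinkPattern (k+2) (p.capIns j) = (pat₀EquivLinkPattern k p).capIns j⁺`); `contract_capIns` (`(p.capIns j).contract j = p`),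
  `capIns_injective`;
* ★★ `Pat₀.mem_capIns_iff` — **ITS LINK RELATION IN CLOSED FORM**: `j ~ j+1`, and `skip j a ~ skip j b` iff `a ~ b` in `p`, nothing else; ★★ `Pat₀.capIns_partner` — its partner is
  `skip j p₀` (`mem_closeUp_capIns_iff` the bridge);
* `capInsL_apply_eq_sum` — `(capInsL j f) Q = Σ_{P : capIns j P = Q} f P`; `capInsL_lawLP_apply_pat₀` — the cap-inserted boundary law of a `k`-marked domain evaluated at an outermost
  `k+2`-pattern `q` is `Σ_{p : p.capIns j = q} N_p` (one term or none);
* ★★★ `lawLP_eq_capInsL_add₃` — **THE LAW ASSEMBLY WITH CAP DATA AND THREE MORE LAWS**: if `N^{W}_q = Σ_{p : p.capIns j = q} N^{D₀}_p + N^{E₁}_q + N^{E₂}_q + N^{E₃}_q` for every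
  outermost `q`, then `lawLP z_W = capInsL j⁺ (lawLP z₀) + lawLP z₁ + lawLP z₂ + lawLP z₃` — the shape of the lane's TWO-CELL CAP IDENTITY
  `law(Ω∪h₁∪h₂; M̂+a+b) = cap_{a,b} law(Ω; M̂) + law(Ω; M̂+P+Q) + law(Ω; M̂+P+c) + law(Ω; M̂+c+Q)` (HOME `FINDING-TWO-CELL-CAP-IDENTITY.md` §2: the Bollobás–Riordan-representable
  replacement of the one-hexagon cap surgery F1), whose count identity is the heir's next car (HOME `pub-sawmu-b-engine-2/gen24/DESIGN-next-gen24.md` §2e).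

## References
* P. A. Pearce, V. Rittenberg, J. de Gier, B. Nienhuis, *Temperley–Lieb stochastic processes*, J. Phys. A 35 (2002) L661–L668, §2 ((monoid): the cup–cap move; the
  link-pattern module).
* M. Khristoforov, S. Smirnov, *Percolation and O(1) loop model*, arXiv:2111.15612v1 (2021), §1.2 (p. 2: «matching marked points», the law of the link pattern).

## Mathlib / tree
Tree: `MarkedLoopPatternContract` (`mem_closeUp_symm_iff`, `castSucc_mem_closeUp_iff`, `castSucc_last_mem_closeUp_iff`, `pat₀EquivLinkPattern_partner_eq_iff`,
`skip_castSucc_castSucc`, `skip_castSucc_last`, `Pat₀.contract`, `pat₀EquivLinkPattern_contract`), `MarkedLoopLawContract` (`eq_castSucc_or_succ_or_skip`),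
`MarkedLoopTemperleyLiebCoords` (`pat₀EquivLinkPattern`), `MarkedLoopBoundaryLawModule` (`lawLP`, `lawLP_apply_pat₀`), `LatticeModels/TemperleyLiebCapContract`
(`PerfectMatching.capIns`, `capIns_partner_castSucc/succ/skip`, `LinkPattern.capIns`, `contractSucc_capIns`, `capInsL`, `skip`, `skip_injective`, `skip_ne_castSucc/succ`).
Mathlib: `Finsupp.mapDomain`, `Finsupp.sum_fintype`, `Finsupp.finsetSum_apply`, `Finsupp.single_apply`, `Equiv.sum_comp`.
-/


namespace Literature.Probability.Percolation.MarkedLoops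

open Literature.Probability.Percolation Literature.Probability.LatticeModels
open Literature.Probability.LatticeModels.TemperleyLieb
open TriMarkedDomain Finset

section CapIns

variable {k : ℕ}

namespace Pat₀

/-- **CAP INSERTION ON OUTERMOST PATTERNS**: the outermost pattern of `k+2` corners whose corners `j, j+1` are linked to each other and whose other corners are linked as in `p`
(relabelled by `skip j`), defined through the bridge `Pat₀ _ ≃ LinkPattern (_+1)` by Pearce–Rittenberg–de Gier–Nienhuis's cap insertion at the sites `j, j+1`.
[cite: PearceRittenbergDeGierNienhuis2002, §2 (monoid: the cup–cap); KhristoforovSmirnov2021, §1.2 (arXiv v1 p. 2)] -/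
noncomputable def capIns (j : Fin (k + 1)) (p : Pat₀ k) : Pat₀ (k + 1 + 1) :=
  (pat₀EquivLinkPattern (k + 1 + 1)).symm ((pat₀EquivLinkPattern k p).capIns (Fin.castSucc j))

/-- **the cap insertion IS the Temperley–Lieb cap insertion in link-pattern coordinates** (by definition). [cite: PearceRittenbergDeGierNienhuis2002, §2 (monoid)] -/
theorem pat₀EquivLinkPattern_capIns (j : Fin (k + 1)) (p : Pat₀ k) :
    pat₀EquivLinkPattern (k + 1 + 1) (p.capIns j) = (pat₀EquivLinkPattern k p).capIns (Fin.castSucc j) :=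
  Equiv.apply_symm_apply _ _

/-- ★ **cap insertion is injective** and **contracting the inserted cap gives the pattern back.** [cite: PearceRittenbergDeGierNienhuis2002, §2 (monoid: `e_j² = e_j` at `δ = 1`)] -/
theorem contract_capIns (j : Fin (k + 1)) (p : Pat₀ k) : (p.capIns j).contract j = p := by
  apply (pat₀EquivLinkPattern k).injective
  rw [pat₀EquivLinkPattern_contract, pat₀EquivLinkPattern_capIns, LinkPattern.contractSucc_capIns]

/-- cap insertion is injective. [cite: PearceRittenbergDeGierNienhuis2002, §2 (monoid)] -/
theorem capIns_injective (j : Fin (k + 1)) : Function.Injective (capIns (k := k) j) :=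
  fun p p' e => by rw [← contract_capIns j p, ← contract_capIns j p', e]

/-- membership in the closed-up inserted pattern = being partners in the cap insertion. [cite: PearceRittenbergDeGierNienhuis2002, §2 (monoid)] -/
theorem mem_closeUp_capIns_iff (j : Fin (k + 1)) (p : Pat₀ k) {x y : Fin (k + 1 + 1 + 1)} :
    (x, y) ∈ (closeUp (p.capIns j)).1 ↔ (PerfectMatching.capIns (Fin.castSucc j) (pat₀EquivLinkPattern k p).1).partner x = y := by
  unfold capIns
  rw [mem_closeUp_symm_iff]
  rfl

/-- ★★ **THE LINK RELATION OF THE INSERTED PATTERN IN CLOSED FORM**: `j ~ j+1`, and `skip j a ~ skip j b` iff `a ~ b` in `p`; nothing else.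
[cite: PearceRittenbergDeGierNienhuis2002, §2 (monoid: the cup–cap); KhristoforovSmirnov2021, §1.2 (arXiv v1 p. 2)] -/
theorem mem_capIns_iff (j : Fin (k + 1)) (p : Pat₀ k) {x y : Fin (k + 1 + 1)} :
    (x, y) ∈ (p.capIns j).1.1.2 ↔ (x = Fin.castSucc j ∧ y = j.succ) ∨ (x = j.succ ∧ y = Fin.castSucc j) ∨
      ∃ a b : Fin k, (a, b) ∈ p.1.1.2 ∧ x = skip j a ∧ y = skip j b := by
  have hjs : Fin.castSucc j ≠ j.succ := ne_of_lt Fin.castSucc_lt_succ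
  rw [← castSucc_mem_closeUp_iff, mem_closeUp_capIns_iff]
  rcases eq_castSucc_or_succ_or_skip j x with rfl | rfl | ⟨a, rfl⟩
  · rw [PerfectMatching.capIns_partner_castSucc, Fin.succ_castSucc, Fin.castSucc_inj]
    constructor
    · rintro rfl; exact Or.inl ⟨rfl, rfl⟩
    · rintro (⟨-, rfl⟩ | ⟨e, -⟩ | ⟨a, b, -, e, -⟩)
      · rfl
      · exact absurd e hjs
      · exact absurd e.symm (skip_ne_castSucc j a)
  · rw [← Fin.succ_castSucc, PerfectMatching.capIns_partner_succ, Fin.castSucc_inj]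
    constructor
    · rintro rfl; exact Or.inr (Or.inl ⟨rfl, rfl⟩)
    · rintro (⟨e, -⟩ | ⟨-, rfl⟩ | ⟨a, b, -, e, -⟩)
      · exact absurd e.symm hjs
      · rfl
      · exact absurd e.symm (skip_ne_succ j a)
  · rw [← skip_castSucc_castSucc, PerfectMatching.capIns_partner_skip]
    constructor
    · intro e
      rcases eq_castSucc_or_succ_or_skip j y with rfl | rfl | ⟨b, rfl⟩
      · exact absurd e (skip_ne_castSucc _ _)
      · rw [← Fin.succ_castSucc] at e; exact absurd e (skip_ne_succ _ _)
      · rw [← skip_castSucc_castSucc, (skip_injective _).eq_iff, pat₀EquivLinkPattern_partner_eq_iff, castSucc_mem_closeUp_iff] at e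
        exact Or.inr (Or.inr ⟨a, b, e, rfl, rfl⟩)
    · rintro (⟨e, -⟩ | ⟨e, -⟩ | ⟨a', b, hab, ea, rfl⟩)
      · exact absurd e (skip_ne_castSucc j a)
      · exact absurd e (skip_ne_succ j a)
      · rw [skip_injective j ea, ← skip_castSucc_castSucc, (skip_injective _).eq_iff, pat₀EquivLinkPattern_partner_eq_iff, castSucc_mem_closeUp_iff]
        exact hab

/-- ★★ **THE PARTNER OF THE INSERTED PATTERN** is the lifted partner `skip j p₀`. [cite: PearceRittenbergDeGierNienhuis2002, §2 (monoid); KhristoforovSmirnov2021, §1.2 (arXiv v1 p. 2)] -/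
theorem capIns_partner (j : Fin (k + 1)) (p : Pat₀ k) : (p.capIns j).1.1.1 = skip j p.1.1.1 := by
  have h1 : (Fin.castSucc (skip j p.1.1.1), Fin.last (k + 1 + 1)) ∈ (closeUp (p.capIns j)).1 := by
    rw [mem_closeUp_capIns_iff, ← skip_castSucc_castSucc, PerfectMatching.capIns_partner_skip, ← skip_castSucc_last, (skip_injective _).eq_iff,
      pat₀EquivLinkPattern_partner_eq_iff, castSucc_last_mem_closeUp_iff]
  exact ((castSucc_last_mem_closeUp_iff _).1 h1).symm

end Pat₀

end CapIns

/-! ### The cap-inserted law: fibre sums and the assembly with three more laws -/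

section Fibre

variable (R : Type*) [CommRing R] {n : ℕ}

/-- **cap insertion evaluated at a link pattern is the sum over the fibre** (a single term, the map being injective): `(capInsL j f) Q = Σ_{P : capIns j P = Q} f P`.
[cite: PearceRittenbergDeGierNienhuis2002, §2 (monoid)] -/
theorem capInsL_apply_eq_sum (j : Fin (n + 1)) (f : LinkPattern n →₀ R) (Q : LinkPattern (n + 1 + 1)) :
    capInsL R j f Q = ∑ P ∈ Finset.univ.filter (fun P : LinkPattern n => P.capIns j = Q), f P := by
  rw [capInsL, Finsupp.lmapDomain_apply, Finsupp.mapDomain, Finsupp.sum_fintype _ _ (fun _ => Finsupp.single_zero _), Finsupp.finsetSum_apply,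
    Finset.sum_filter]
  exact Finset.sum_congr rfl fun P _ => Finsupp.single_apply

variable {R}

/-- **the cap-inserted boundary law of a `k`-marked domain, evaluated at an outermost `k+2`-pattern `q`, is `Σ_{p : p.capIns j = q} N_p`.**
[cite: KhristoforovSmirnov2021, §1.2 (arXiv v1 p. 2: the law of the link pattern); PearceRittenbergDeGierNienhuis2002, §2 (monoid)] -/
theorem capInsL_lawLP_apply_pat₀ {D₀ : TriMarkedDomain (n + 1)} (z₀ : ArcPoint D₀ (Fin.last n)) (j : Fin (n + 1 + 1)) (q : Pat₀ (n + 1 + 1 + 1)) :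
    capInsL ℂ (Fin.castSucc j) (lawLP z₀) (pat₀EquivLinkPattern (n + 1 + 1 + 1) q) =
      ∑ p ∈ Finset.univ.filter (fun p : Pat₀ (n + 1) => p.capIns j = q), (patternCount D₀ z₀.v z₀.i p.1 : ℂ) := by
  rw [capInsL_apply_eq_sum, Finset.sum_filter, Finset.sum_filter, ← (pat₀EquivLinkPattern (n + 1)).sum_comp]
  refine Finset.sum_congr rfl fun p _ => ?_
  rw [← Pat₀.pat₀EquivLinkPattern_capIns, lawLP_apply_pat₀]
  exact if_congr (pat₀EquivLinkPattern (n + 1 + 1 + 1)).apply_eq_iff_eq rfl rfl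

/-- ★★★ **THE LAW ASSEMBLY WITH CAP DATA AND THREE MORE LAWS** (the shape of the lane's TWO-CELL CAP IDENTITY, HOME `FINDING-TWO-CELL-CAP-IDENTITY.md` §2): if at a boundary mid-edge
the outermost-pattern counts of `W`, `E₁`, `E₂`, `E₃` (`k+2` corners) and `D₀` (`k` corners) satisfy `N^{W}_q = Σ_{p : p.capIns j = q} N^{D₀}_p + N^{E₁}_q + N^{E₂}_q + N^{E₃}_q` for every
outermost `q`, then `lawLP z_W = capInsL j (lawLP z₀) + lawLP z₁ + lawLP z₂ + lawLP z₃`.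
[cite: KhristoforovSmirnov2021, §1.2 (arXiv v1 p. 2: the law of the link pattern); PearceRittenbergDeGierNienhuis2002, §2 (monoid; the link-pattern module)] -/
theorem lawLP_eq_capInsL_add₃ {W E₁ E₂ E₃ : TriMarkedDomain (n + 1 + 1 + 1)} {D₀ : TriMarkedDomain (n + 1)} (zW : ArcPoint W (Fin.last (n + 1 + 1)))
    (z₁ : ArcPoint E₁ (Fin.last (n + 1 + 1))) (z₂ : ArcPoint E₂ (Fin.last (n + 1 + 1))) (z₃ : ArcPoint E₃ (Fin.last (n + 1 + 1))) (z₀ : ArcPoint D₀ (Fin.last n))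
    (j : Fin (n + 1 + 1))
    (hcount : ∀ q : Pat₀ (n + 1 + 1 + 1), patternCount W zW.v zW.i q.1 =
      (∑ p ∈ Finset.univ.filter (fun p : Pat₀ (n + 1) => p.capIns j = q), patternCount D₀ z₀.v z₀.i p.1) +
        patternCount E₁ z₁.v z₁.i q.1 + patternCount E₂ z₂.v z₂.i q.1 + patternCount E₃ z₃.v z₃.i q.1) :
    lawLP zW = capInsL ℂ (Fin.castSucc j) (lawLP z₀) + lawLP z₁ + lawLP z₂ + lawLP z₃ := by
  ext Q
  obtain ⟨q, rfl⟩ := (pat₀EquivLinkPattern (n + 1 + 1 + 1)).surjective Q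
  rw [Finsupp.add_apply, Finsupp.add_apply, Finsupp.add_apply, lawLP_apply_pat₀, lawLP_apply_pat₀, lawLP_apply_pat₀, lawLP_apply_pat₀, capInsL_lawLP_apply_pat₀, hcount q,
    Nat.cast_add, Nat.cast_add, Nat.cast_add, Nat.cast_sum]

end Fibre

end Literature.Probability.Percolation.MarkedLoops
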